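import Summits.QuantumFields.BalabanUV.Beta.EriceRemainderEnclosureHistoryAutonomyComparisonAgeCompositionOldTripleLetters
import Summits.QuantumFields.BalabanUV.Beta.EriceRemainderEnclosureHistoryAutonomyComparisonAgeCompositionTripleBox

/-!
# EriceRemainderEnclosureHistoryAutonomyComparisonAgeCompositionOldTripleLeaf — (E103c) route (N), first order: THE LEAF OF THE OLD-TRIPLE CAP.
# One box of the four shape parameters of an old triple `56 ≤ j < k < n` (`k∕j ∈ [F₁l, F₁h]`, `n∕k ∈ [F₂l, F₂h]`, `σ₁ = h_{m+j}∕h_{m+k} ∈ [s₁l, s₁h]`,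
# `σ₂ = h_{m+k}∕h_{m+n} ∈ [s₂l, s₂h]`; a top box may give `F₁h ≤ s₁h²` ∕ `F₂h ≤ s₂h²` instead, by the pin rays) is either CERTIFIED — rational data
# (three split ratios `θᵢ` with `θᵢlo = θᵢ − 1∕56`, ray constants `c_{Tᵢ}²(2+θᵢ+1∕56) ≤ 2`, far∕older constants `cᵢ²(2F+57∕56) ≤ 2F`, six corner values,
# three multipliers `λᵢ ≥ 0` with `Σλᵢ ≤ V` covering the three columns; forty rational side conditions closed by `norm_num`) ⟹ `x_j + x_k + x_n ≤ V`
# (**`old_triple_leaf`**: `Tᵢ = ⌊θᵢ·age⌋`, (E103a) letters, (E103b) `old_triple_box`) — or VOID: the chord concavity of (E103a) `triple_sigma_bounds`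
# fails on the whole box, `(F₁l−1)s₁l²(s₂l²−1) > (F₂h−1)F₁h(s₁h²−1)` (**`old_triple_void`**, any conclusion).  The tables (one theorem per cell of
# `(k∕j, n∕k)` brackets, a kd-tree of `rcases` on the four parameters) are the sequels; generator `HOME/b2b-balaban-beta-d4-p2/g89/numerics/cert_triple2.py`.

Cell `pub-balaban`, β-function sub-cell, BINDER row D4 «RemainderConst leaves for Bałaban's split» (`HOME/BINDER-OWNERS.md`; owner lineage `b2b-balaban-beta-an4`;
this file by co-owner #2 lineage `b2b-balaban-beta-d4-p2`, generation 89), β-FLOW TEAM duty (1), FREEZE (0) honoured (def-free; nothing restated).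

HONEST FRAMING (page 1, verbatim and binding).  *"Discharging BetaPertH makes Bałaban's UV stability UNCONDITIONAL — a real constructive-QFT result; it is
NOT the continuum limit and NOT the Clay problem."*  THIS FILE DISCHARGES NOTHING OF THE KIND.  Elementary real algebra ∕ real analysis about ABSTRACT
functionals on a box ]0,γ]^ℕ with displayed floors, profiles and signs, and the FIRST-ORDER renewal objects of route (N) built from them — hypotheses of a
census, not facts; the form, signs, ages and moments of Bałaban's (1.22) limit functional are NOT PRINTED ([I] p. 298; GAPS G-t4-U2-1∕-2) and NOT asserted.
Row D4 class UNCHANGED (critical-path width 0; instance 0∕1; D4 DISCHARGE NO DATE).  HONEST DEPENDENCY: continuum YM on T⁴ ⇐ BetaPertH ∧ nine spine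
estimates (0/9 proved); BetaPertH ⇐ (D1) ∧ (D4) ∧ CAP+tail; G-an2-4 gates asym, D1 and NE2/3/4.

THE POINT (README `HOME/b2b-balaban-beta-d4-p2/g89/README.md` §3).  Uses (E103a) `triple_sigma_bounds`, `triple_letter_young ∕ _mid ∕ _old`, (E103b) `old_triple_box`
BY NAME.  NOT CLAIMED: any table (sequels); anything printed — NOT B12 Thm 2, NOT BetaPertH, NOT continuum, NOT Clay.

WHAT IS PROVED ([folklore]; 0 `def`, 0 sorry).  §1 `own_const_56`, `split_data`, `far_const`, **`old_triple_leaf`**.  §2 **`old_triple_void`**.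
-/
noncomputable section
open Finset

namespace Summit.QuantumFields.BalabanUV.Beta.EriceRemainderEnclosureHistoryAutonomyComparisonAgeCompositionOldTripleLeaf

open Literature.MathematicalPhysics.QuantumFieldTheory.Balaban1983to89
open Literature.MathematicalPhysics.QuantumFieldTheory.Balaban1983to89.T4BetaStationary
open Literature.MathematicalPhysics.QuantumFieldTheory.Balaban1983to89.T4BetaFlowWellPosed
open Summit.QuantumFields.BalabanUV.Beta.EriceRemainderEnclosureHistoryAutonomyComparisonAgeCompositionOldTripleLetters
  (triple_sigma_bounds triple_letter_young triple_letter_mid triple_letter_old)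
open Summit.QuantumFields.BalabanUV.Beta.EriceRemainderEnclosureHistoryAutonomyComparisonAgeCompositionTripleBox (old_triple_box)

variable {B : (ℕ → ℝ) → ℝ} {γ b gIR : ℝ} {L : ℕ → ℝ} {K : ℕ} {h : ℕ → ℝ}

/-! ## §1 The certified leaf -/

/-- The own-window constant `c₀ = 407∕500` is valid from age 55 on: `c₀²(3u+1) ≤ 2u` for `u ≥ 56`. [folklore] -/
theorem own_const_56 {u : ℝ} (hu : 56 ≤ u) : (407 / 500 : ℝ) ^ 2 * (3 * u + 1) ≤ 2 * u := by
  nlinarith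

/-- **THE SPLIT DATA OF A BOX.**  A young age `u ≥ 56` (real) whose older partner satisfies `Fl·u ≤ w`, a split ratio `θ` with `θlo·56 + 1 ≤ θ·56`,
`θlo ≥ 0`, `θ + 1 ≤ Fl`, and a ray constant `c_T ≥ 0` with `c_T²(2+θ+1∕56) ≤ 2`: the natural `T = ⌊θu⌋` satisfies `θlo·u ≤ T ≤ θ·u`, `T + u ≤ w` and
`c_T²(2u+T+1) ≤ 2u`. [folklore] -/
theorem split_data {u w θ θlo Fl cT : ℝ} (hu : 56 ≤ u) (hw : Fl * u ≤ w) (hθlo : 0 ≤ θlo) (hθ : θlo * 56 + 1 ≤ θ * 56) (hθF : θ + 1 ≤ Fl)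
    (hcT : cT ^ 2 * (2 + θ + 1 / 56) ≤ 2) :
    θlo * u ≤ (⌊θ * u⌋₊ : ℕ) ∧ ((⌊θ * u⌋₊ : ℕ) : ℝ) ≤ θ * u ∧ ((⌊θ * u⌋₊ : ℕ) : ℝ) + u ≤ w
      ∧ cT ^ 2 * (2 * u + (⌊θ * u⌋₊ : ℕ) + 1) ≤ 2 * u := by
  have hupos : 0 < u := by linarith
  have hθpos : 0 < θ := by nlinarith
  have hθu : 0 ≤ θ * u := by positivity
  have hTle : ((⌊θ * u⌋₊ : ℕ) : ℝ) ≤ θ * u := Nat.floor_le hθu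
  have hTgt : θ * u < ((⌊θ * u⌋₊ : ℕ) : ℝ) + 1 := Nat.lt_floor_add_one _
  refine ⟨?_, hTle, by nlinarith, ?_⟩
  · have : 1 ≤ (θ - θlo) * u := by nlinarith
    linarith
  · have h1 : 2 * u + ((⌊θ * u⌋₊ : ℕ) : ℝ) + 1 ≤ u * (2 + θ + 1 / 56) := by nlinarith
    calc cT ^ 2 * (2 * u + ((⌊θ * u⌋₊ : ℕ) : ℝ) + 1) ≤ cT ^ 2 * (u * (2 + θ + 1 / 56)) := mul_le_mul_of_nonneg_left h1 (sq_nonneg _)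
      _ = u * (cT ^ 2 * (2 + θ + 1 / 56)) := by ring
      _ ≤ u * 2 := mul_le_mul_of_nonneg_left hcT hupos.le
      _ = 2 * u := by ring

/-- **THE FAR ∕ OLDER CONSTANT OF A BOX.**  Ages `56 ≤ u`, `Fl·u ≤ w` (`Fl > 0`) and `c²(2Fl + 57∕56) ≤ 2Fl` give the tangent condition `c²(2w+u+1) ≤ 2w`.
[folklore] -/
theorem far_const {u w Fl c : ℝ} (hu : 56 ≤ u) (hw : Fl * u ≤ w) (hFl : 0 < Fl) (hc : c ^ 2 * (2 * Fl + 57 / 56) ≤ 2 * Fl) :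
    c ^ 2 * (2 * w + u + 1) ≤ 2 * w := by
  have hupos : 0 < u := by linarith
  have hkF : u ≤ w / Fl := by rw [le_div_iff₀ hFl]; linarith
  have hkF0 : 0 ≤ w / Fl := le_trans hupos.le hkF
  have h1 : 2 * w + u + 1 ≤ w / Fl * (2 * Fl + 57 / 56) := by
    have e : w / Fl * (2 * Fl + 57 / 56) = 2 * w + 57 / 56 * (w / Fl) := by field_simp
    rw [e]; nlinarith
  calc c ^ 2 * (2 * w + u + 1) ≤ c ^ 2 * (w / Fl * (2 * Fl + 57 / 56)) := mul_le_mul_of_nonneg_left h1 (sq_nonneg _)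
    _ = w / Fl * (c ^ 2 * (2 * Fl + 57 / 56)) := by ring
    _ ≤ w / Fl * (2 * Fl) := mul_le_mul_of_nonneg_left hc hkF0
    _ = 2 * w := by field_simp

/-- **THE LEAF OF THE OLD-TRIPLE CAP.**  `B` an isotone memory with floor `b > 0` dominating `L ≥ 0`, `h` a box solution, old ages `56 ≤ j < k < n < K` in
the box `F₁l·j ≤ k ≤ F₁h·j`, `F₂l·k ≤ n ≤ F₂h·k`, `σ₁ = h_{m+j}∕h_{m+k} ∈ [s₁l, s₁h]`, `σ₂ = h_{m+k}∕h_{m+n} ∈ [s₂l, s₂h]` (or the pin-ray forms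
`F₁h ≤ s₁h²`, `F₂h ≤ s₂h²`), and rational data passing the side conditions of the module docstring.  THEN `x_j(m) + x_k(m) + x_n(m) ≤ V`. [folklore] -/
theorem old_triple_leaf (hmono : ∀ u v : ℕ → ℝ, SeqBox γ u → SeqBox γ v → (∀ j, u j ≤ v j) → B u ≤ B v)
    (hL : ∀ k, 0 ≤ L k) (hb : 0 < b) (hlo : ∀ u, SeqBox γ u → b ≤ B u) (hdom : ∀ u, SeqBox γ u → ∑ k ∈ range K, L k * u k ≤ B u)
    (hh : SeqBox γ h) (hf : MemFlow B gIR h) {j k n : ℕ} (h56 : 56 ≤ j) (hjk : j < k) (hkn : k < n) (hnK : n < K) (m : ℕ)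
    {F₁l F₁h F₂l F₂h s₁l s₁h s₂l s₂h θ₁ θ₁lo θ₂ θ₂lo θ₃ θ₃lo cT₁ cT₂ cT₃ c₁ c₂ c₃ Jz Jy Kx₁ Jy₂ Kx₂ Kz l₁ l₂ l₃ V : ℝ}
    (hk1 : F₁l * j ≤ k) (hk2 : (k : ℝ) ≤ F₁h * j) (hn1 : F₂l * k ≤ n) (hn2 : (n : ℝ) ≤ F₂h * k)
    (hσ₁l : s₁l ≤ h (m + j) / h (m + k)) (hσ₁h : h (m + j) / h (m + k) ≤ s₁h ∨ F₁h ≤ s₁h ^ 2)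
    (hσ₂l : s₂l ≤ h (m + k) / h (m + n)) (hσ₂h : h (m + k) / h (m + n) ≤ s₂h ∨ F₂h ≤ s₂h ^ 2)
    (hnum : (0 < s₁l ∧ 0 < s₁h ∧ 0 < s₂l ∧ 0 < s₂h)
      ∧ (0 ≤ θ₁lo ∧ θ₁lo * 56 + 1 ≤ θ₁ * 56 ∧ θ₁ + 1 ≤ F₁l ∧ 0 ≤ cT₁ ∧ cT₁ ^ 2 * (2 + θ₁ + 1 / 56) ≤ 2)
      ∧ (0 ≤ θ₂lo ∧ θ₂lo * 56 + 1 ≤ θ₂ * 56 ∧ θ₂ + 1 ≤ F₁l * F₂l ∧ 0 ≤ cT₂ ∧ cT₂ ^ 2 * (2 + θ₂ + 1 / 56) ≤ 2)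
      ∧ (0 ≤ θ₃lo ∧ θ₃lo * 56 + 1 ≤ θ₃ * 56 ∧ θ₃ + 1 ≤ F₂l ∧ 0 ≤ cT₃ ∧ cT₃ ^ 2 * (2 + θ₃ + 1 / 56) ≤ 2)
      ∧ (0 ≤ c₁ ∧ c₁ ^ 2 * (2 * F₁l + 57 / 56) ≤ 2 * F₁l ∧ 0 ≤ c₂ ∧ c₂ ^ 2 * (2 * (F₁l * F₂l) + 57 / 56) ≤ 2 * (F₁l * F₂l)
          ∧ 0 ≤ c₃ ∧ c₃ ^ 2 * (2 * F₂l + 57 / 56) ≤ 2 * F₂l)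
      ∧ (Jz ≤ 2 * c₁ * s₁l ^ 2 / F₁h ∧ Jy ≤ 2 * c₂ * (s₁l * s₂l) ^ 2 / (F₁h * F₂h)
          ∧ Kx₁ ≤ 2 * cT₁ * θ₁lo / s₁h ^ 2 + 2 * (F₁l - 1 - θ₁ + c₁) / s₁h ^ 3 ∧ Jy₂ ≤ 2 * c₃ * s₂l ^ 2 / F₂h
          ∧ Kx₂ ≤ 2 * cT₂ * θ₂lo / (s₁h * s₂h) ^ 2 + 2 * (F₁l * F₂l - 1 - θ₂ + c₂) / (s₁h * s₂h) ^ 3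
          ∧ Kz ≤ 2 * cT₃ * θ₃lo / s₂h ^ 2 + 2 * (F₂l - 1 - θ₃ + c₃) / s₂h ^ 3)
      ∧ (0 ≤ l₁ ∧ 0 ≤ l₂ ∧ 0 ≤ l₃ ∧ 1 ≤ l₁ * (2 * (407 / 500)) + l₂ * Kx₁ + l₃ * Kx₂ ∧ 1 ≤ l₁ * Jz + l₂ * (2 * (407 / 500)) + l₃ * Kz
          ∧ 1 ≤ l₁ * Jy + l₂ * Jy₂ + l₃ * (2 * (407 / 500)) ∧ l₁ + l₂ + l₃ ≤ V)) :
    (j : ℝ) * (L j * h (m + j) ^ 3 / 2) + (k : ℝ) * (L k * h (m + k) ^ 3 / 2) + (n : ℝ) * (L n * h (m + n) ^ 3 / 2) ≤ V := by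
  obtain ⟨⟨hs₁l, hs₁h, hs₂l, hs₂h⟩, ⟨hθ₁lo, hθ₁, hθ₁F, hcT₁0, hcT₁⟩, ⟨hθ₂lo, hθ₂, hθ₂F, hcT₂0, hcT₂⟩, ⟨hθ₃lo, hθ₃, hθ₃F, hcT₃0, hcT₃⟩,
    ⟨hc₁0, hc₁, hc₂0, hc₂, hc₃0, hc₃⟩, ⟨hJz, hJy, hKx₁, hJy₂, hKx₂, hKz⟩, ⟨hl₁, hl₂, hl₃, hcx, hcz, hcy, hV⟩⟩ := hnum
  have hpos : ∀ n, 0 < h n := fun n => (hh n).1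
  have hjr : (56 : ℝ) ≤ j := by exact_mod_cast h56
  have hjpos : (0 : ℝ) < j := by linarith
  have hkr : (56 : ℝ) ≤ k := le_trans hjr (by exact_mod_cast hjk.le)
  have hj1 : 1 ≤ j := by omega
  have hF₁l : 1 < F₁l := by linarith
  have hF₂l : 1 < F₂l := by linarith
  have hnj : F₁l * F₂l * j ≤ n :=
    calc F₁l * F₂l * j = F₂l * (F₁l * j) := by ring
      _ ≤ F₂l * k := mul_le_mul_of_nonneg_left hk1 (by linarith)
      _ ≤ n := hn1
  have hc₀ := own_const_56 hjr
  -- the three splits and the far constants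
  obtain ⟨hT₁l, hT₁h, hT₁w, hcT₁'⟩ := split_data hjr hk1 hθ₁lo hθ₁ hθ₁F hcT₁
  obtain ⟨hT₂l, hT₂h, hT₂w, hcT₂'⟩ := split_data hjr hnj hθ₂lo hθ₂ hθ₂F hcT₂
  obtain ⟨hT₃l, hT₃h, hT₃w, hcT₃'⟩ := split_data hkr hn1 hθ₃lo hθ₃ hθ₃F hcT₃
  have hc₁' : c₁ ^ 2 * (2 * (k : ℝ) + j + 1) ≤ 2 * k := far_const hjr hk1 (by linarith) hc₁
  have hc₂' : c₂ ^ 2 * (2 * (n : ℝ) + j + 1) ≤ 2 * n := far_const hjr hnj (mul_pos (by linarith) (by linarith)) hc₂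
  have hc₃' : c₃ ^ 2 * (2 * (n : ℝ) + k + 1) ≤ 2 * n := far_const hkr hn1 (by linarith) hc₃
  have hT₁k : ⌊θ₁ * (j : ℝ)⌋₊ + j ≤ k := by exact_mod_cast hT₁w
  have hT₂n : ⌊θ₂ * (j : ℝ)⌋₊ + j ≤ n := by exact_mod_cast hT₂w
  have hT₃n : ⌊θ₃ * (k : ℝ)⌋₊ + k ≤ n := by exact_mod_cast hT₃w
  -- the letters and the geometry
  have hWj := triple_letter_young hmono hL hb hlo hdom hh hf hj1 hjk hkn hnK hc₀ hc₁' hc₂' m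
  have hWk := triple_letter_mid hmono hL hb hlo hdom hh hf hj1 hjk hkn hnK hT₁k hc₀ hc₁' hc₃' hcT₁' m
  have hWn := triple_letter_old hmono hL hb hlo hdom hh hf hj1 hjk hkn hnK hT₂n hT₃n hc₀ hc₂' hc₃' hcT₂' hcT₃' m
  obtain ⟨hs1, hs2, hr1, hr2, -⟩ := triple_sigma_bounds hmono hL hb hlo hdom hh hf hj1 hjk hkn hnK m
  have hσ₁0 : 0 < h (m + j) / h (m + k) := lt_of_lt_of_le one_pos hs1
  have hσ₂0 : 0 < h (m + k) / h (m + n) := lt_of_lt_of_le one_pos hs2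
  have hkpos : (0 : ℝ) < k := by linarith
  have hσ₁h' : h (m + j) / h (m + k) ≤ s₁h := by
    rcases hσ₁h with h2 | h2
    · exact h2
    · have h3 : (h (m + j) / h (m + k)) ^ 2 * j ≤ s₁h ^ 2 * j :=
        le_trans hr1 (le_trans hk2 (mul_le_mul_of_nonneg_right h2 hjpos.le))
      exact (pow_le_pow_iff_left₀ hσ₁0.le hs₁h.le two_ne_zero).mp (le_of_mul_le_mul_right h3 hjpos)
  have hσ₂h' : h (m + k) / h (m + n) ≤ s₂h := by
    rcases hσ₂h with h2 | h2
    · exact h2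
    · have h3 : (h (m + k) / h (m + n)) ^ 2 * k ≤ s₂h ^ 2 * k :=
        le_trans hr2 (le_trans hn2 (mul_le_mul_of_nonneg_right h2 hkpos.le))
      exact (pow_le_pow_iff_left₀ hσ₂0.le hs₂h.le two_ne_zero).mp (le_of_mul_le_mul_right h3 hkpos)
  have hx : 0 ≤ (j : ℝ) * (L j * h (m + j) ^ 3 / 2) := by have := hL j; have := hpos (m + j); positivity
  have hz : 0 ≤ (k : ℝ) * (L k * h (m + k) ^ 3 / 2) := by have := hL k; have := hpos (m + k); positivity
  have hy : 0 ≤ (n : ℝ) * (L n * h (m + n) ^ 3 / 2) := by have := hL n; have := hpos (m + n); positivity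
  exact old_triple_box hx hz hy (by norm_num : (0 : ℝ) < 56) hjr hk1 hk2 hn1 hn2 hF₁l.le hF₂l.le hσ₁l hσ₁h' hσ₂l hσ₂h' hs₁l hs₂l
    hT₁l hT₁h hT₂l hT₂h hT₃l hT₃h hθ₁lo hθ₂lo hθ₃lo hθ₁F hθ₂F hθ₃F hc₁0 hc₂0 hc₃0 hcT₁0 hcT₂0 hcT₃0 hWj hWk hWn
    hJz hJy hKx₁ hJy₂ hKx₂ hKz hl₁ hl₂ hl₃ hcx hcz hcy hV

/-! ## §2 The void leaf -/

/-- **THE VOID LEAF OF THE OLD-TRIPLE CAP.**  In the same box, if `1 ≤ F₁l`, `1 ≤ s₂l`, `0 < s₁l` and the chord concavity fails on the whole box —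
`(F₂h − 1)·F₁h·(s₁h² − 1) < (F₁l − 1)·s₁l²·(s₂l² − 1)` — the box contains no admissible configuration ((E103a) `triple_sigma_bounds`), so any conclusion
holds; stated as the cap `≤ V`. [folklore] -/
theorem old_triple_void (hmono : ∀ u v : ℕ → ℝ, SeqBox γ u → SeqBox γ v → (∀ j, u j ≤ v j) → B u ≤ B v)
    (hL : ∀ k, 0 ≤ L k) (hb : 0 < b) (hlo : ∀ u, SeqBox γ u → b ≤ B u) (hdom : ∀ u, SeqBox γ u → ∑ k ∈ range K, L k * u k ≤ B u)
    (hh : SeqBox γ h) (hf : MemFlow B gIR h) {j k n : ℕ} (h56 : 56 ≤ j) (hjk : j < k) (hkn : k < n) (hnK : n < K) (m : ℕ)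
    {F₁l F₁h F₂h s₁l s₁h s₂l V : ℝ}
    (hk1 : F₁l * j ≤ k) (hk2 : (k : ℝ) ≤ F₁h * j) (hn2 : (n : ℝ) ≤ F₂h * k)
    (hσ₁l : s₁l ≤ h (m + j) / h (m + k)) (hσ₁h : h (m + j) / h (m + k) ≤ s₁h ∨ F₁h ≤ s₁h ^ 2)
    (hσ₂l : s₂l ≤ h (m + k) / h (m + n))
    (hnum : 1 ≤ F₁l ∧ 0 < s₁l ∧ 0 < s₁h ∧ 1 ≤ s₂l ∧ (F₂h - 1) * F₁h * (s₁h ^ 2 - 1) < (F₁l - 1) * s₁l ^ 2 * (s₂l ^ 2 - 1)) :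
    (j : ℝ) * (L j * h (m + j) ^ 3 / 2) + (k : ℝ) * (L k * h (m + k) ^ 3 / 2) + (n : ℝ) * (L n * h (m + n) ^ 3 / 2) ≤ V := by
  obtain ⟨hF₁l, hs₁l, hs₁h, hs₂l, hvoid⟩ := hnum
  exfalso
  have hjr : (56 : ℝ) ≤ j := by exact_mod_cast h56
  have hjpos : (0 : ℝ) < j := by linarith
  have hkjr : (j : ℝ) < k := by exact_mod_cast hjk
  have hnkr : (k : ℝ) < n := by exact_mod_cast hkn
  have hkpos : (0 : ℝ) < k := by linarith
  obtain ⟨hs1, hs2, hr1, -, hchord⟩ := triple_sigma_bounds hmono hL hb hlo hdom hh hf (by omega) hjk hkn hnK m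
  have hσ₁0 : 0 < h (m + j) / h (m + k) := lt_of_lt_of_le one_pos hs1
  -- σ₁² ≤ s₁h²
  have hσ₁sq : (h (m + j) / h (m + k)) ^ 2 ≤ s₁h ^ 2 := by
    rcases hσ₁h with h2 | h2
    · exact pow_le_pow_left₀ hσ₁0.le h2 2
    · have h3 : (h (m + j) / h (m + k)) ^ 2 * j ≤ s₁h ^ 2 * j :=
        le_trans hr1 (le_trans hk2 (mul_le_mul_of_nonneg_right h2 hjpos.le))
      exact le_of_mul_le_mul_right h3 hjpos
  -- F₂h ≥ 1 (n > k), F₁h ≥ 0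
  have hF₂h : 1 ≤ F₂h := by
    by_contra hneg
    push Not at hneg
    have : F₂h * k < 1 * k := mul_lt_mul_of_pos_right hneg hkpos
    linarith
  have hF₁h : 0 ≤ F₁h := by
    by_contra hneg
    push Not at hneg
    have : F₁h * j < 0 := mul_neg_of_neg_of_pos hneg hjpos
    linarith
  -- lower bound of the left side, upper bound of the right side of the chord inequality
  have hA1 : (F₁l - 1) * j ≤ (k : ℝ) - j := by linarith
  have hA2 : s₁l ^ 2 ≤ (h (m + j) / h (m + k)) ^ 2 := pow_le_pow_left₀ hs₁l.le hσ₁l 2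
  have hA3 : s₂l ^ 2 - 1 ≤ (h (m + k) / h (m + n)) ^ 2 - 1 := by
    have := pow_le_pow_left₀ (by linarith : (0 : ℝ) ≤ s₂l) hσ₂l 2; linarith
  have hA30 : 0 ≤ s₂l ^ 2 - 1 := by
    have h1 : (1 : ℝ) ^ 2 ≤ s₂l ^ 2 := pow_le_pow_left₀ zero_le_one hs₂l 2
    rw [one_pow] at h1; linarith
  have hA10 : 0 ≤ (F₁l - 1) * j := mul_nonneg (by linarith) hjpos.le
  have hlow : (F₁l - 1) * j * s₁l ^ 2 * (s₂l ^ 2 - 1)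
      ≤ ((k : ℝ) - j) * (h (m + j) / h (m + k)) ^ 2 * ((h (m + k) / h (m + n)) ^ 2 - 1) :=
    mul_le_mul (mul_le_mul hA1 hA2 (sq_nonneg _) (by linarith)) hA3 hA30 (mul_nonneg (by linarith) (sq_nonneg _))
  have hB1 : (n : ℝ) - k ≤ (F₂h - 1) * F₁h * j :=
    calc (n : ℝ) - k ≤ (F₂h - 1) * k := by linarith
      _ ≤ (F₂h - 1) * (F₁h * j) := mul_le_mul_of_nonneg_left hk2 (by linarith)
      _ = (F₂h - 1) * F₁h * j := by ring
  have hB2 : (h (m + j) / h (m + k)) ^ 2 - 1 ≤ s₁h ^ 2 - 1 := by linarith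
  have hB20 : 0 ≤ (h (m + j) / h (m + k)) ^ 2 - 1 := by
    have h1 : (1 : ℝ) ^ 2 ≤ (h (m + j) / h (m + k)) ^ 2 := pow_le_pow_left₀ zero_le_one hs1 2
    rw [one_pow] at h1; linarith
  have hhigh : ((n : ℝ) - k) * ((h (m + j) / h (m + k)) ^ 2 - 1) ≤ (F₂h - 1) * F₁h * j * (s₁h ^ 2 - 1) :=
    mul_le_mul hB1 hB2 hB20 (mul_nonneg (mul_nonneg (by linarith) hF₁h) hjpos.le)
  have hv : (F₂h - 1) * F₁h * j * (s₁h ^ 2 - 1) < (F₁l - 1) * j * s₁l ^ 2 * (s₂l ^ 2 - 1) := by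
    have h1 := mul_lt_mul_of_pos_right hvoid hjpos
    have e1 : (F₂h - 1) * F₁h * (s₁h ^ 2 - 1) * j = (F₂h - 1) * F₁h * j * (s₁h ^ 2 - 1) := by ring
    have e2 : (F₁l - 1) * s₁l ^ 2 * (s₂l ^ 2 - 1) * j = (F₁l - 1) * j * s₁l ^ 2 * (s₂l ^ 2 - 1) := by ring
    rw [e1, e2] at h1; exact h1
  linarith [hlow, hhigh, hchord, hv]

end Summit.QuantumFields.BalabanUV.Beta.EriceRemainderEnclosureHistoryAutonomyComparisonAgeCompositionOldTripleLeaf
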